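import Mathlib
import Summits.ValiantsHypothesis.ValiantsHypothesis.Theorems.DetQPDetqpSuperquadraticStubKrylovIdentities
import Summits.ValiantsHypothesis.ValiantsHypothesis.Theorems.DetQPDetqpSuperquadraticStubVertexGauge
import Literature.Computability.AlgebraicComplexity.StandardFamiliesProofs
import Literature.Computability.AlgebraicComplexity.DeterminantalComplexityProofs

/-!
# Crux `DetQP.DetqpSuperquadratic` (stmt-ValiantsHypothesis-0318), line
# `linear-homogenisation-transfer` — stub `stub_krylovAdjugateOrder` (B3): the bordered adjugate
# form of a Krylov normal form and its initial form

Let `ρ, γ ∈ (S¹)^w`, `L ∈ M_w(S¹)` be homogeneous LINEAR data over `S = ℂ[x_ij]` with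
(A3) `ρᵀ L^(n−2) γ = per_n` and (A2) `ρᵀ Lʲ γ = 0` for `j < n − 2` (`n ≥ 2`).  Put
`F := ρᵀ adj(1 − L) γ`.  Then

* (i) `F` is the determinant of the affine bordered matrix `[[0, −ρᵀ], [γ, 1 − L]]` of size
  `w + 1` (`VertexGauge.det_bordered`, usable since `det (1 − L)` has constant coefficient `1`),
  so `HasDetRepr F (w + 1)`;
* (ii) `F` has no homogeneous component of degree `< n`;
* (iii) the homogeneous component of degree `n` of `F` is `per_n`.

For (ii)/(iii) write `n = k + 2`; `Krylov.adjugate_contraction_eq ρ γ L (k + 1)` gives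
`F = det(1 − L) · Σ_{i ≤ k} ρᵀ Lⁱ γ + ρᵀ L^(k+1) adj(1 − L) γ = det(1 − L) · per_n + E`, where every
summand of `E` is a multiple of a form `ρ_a (L^(k+1))_{ac} γ_b` of degree `k + 3 = n + 1`, so `E`
has no component of degree `≤ n`, while `[det(1 − L) · per_n]_d = [det(1 − L)]_{d−n} · per_n`
vanishes for `d < n` and equals `per_n` for `d = n`.  (Folklore; this is the order computation behind
Chatterjee–Kumar–Volk 2024, Thm. 13, run in the converse direction.)
-/

noncomputable section

-- `Summit.ValiantsHypothesis.ValiantsHypothesis.…` is the tree's mandated single-conjunct layout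
-- (Sub = Summit), so the duplicated namespace component is intended.
set_option linter.dupNamespace false

namespace Summit.ValiantsHypothesis.ValiantsHypothesis.Theorems.DetQPDetqpSuperquadratic

open MvPolynomial Matrix
open Literature.Computability.AlgebraicComplexity

namespace KrylovAdjugateOrder

/-- `det (1 − L)` has constant coefficient `1` when `L` has homogeneous linear entries.
[folklore] -/
theorem constantCoeff_det_one_sub {σ : Type*} {K : Type*} [CommRing K] {w : ℕ}
    {L : Matrix (Fin w) (Fin w) (MvPolynomial σ K)} (hL : ∀ i j, (L i j).IsHomogeneous 1) :
    constantCoeff ((1 - L).det) = 1 := by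
  have h := Krylov.constantCoeff_det_one_add (L := -L) fun i j => by
    rw [Matrix.neg_apply]; exact (hL i j).neg
  rwa [← sub_eq_add_neg] at h

/-- `det (1 − L) ≠ 0` when `L` has homogeneous linear entries over a nontrivial ring.
[folklore] -/
theorem det_one_sub_ne_zero {σ : Type*} {K : Type*} [CommRing K] [Nontrivial K] {w : ℕ}
    {L : Matrix (Fin w) (Fin w) (MvPolynomial σ K)} (hL : ∀ i j, (L i j).IsHomogeneous 1) :
    (1 - L).det ≠ 0 := by
  intro h0
  have := constantCoeff_det_one_sub hL
  rw [h0, map_zero] at this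
  exact zero_ne_one this

/-- **(i) The bordered adjugate form is an affine determinantal expression of size `w + 1`.**
For homogeneous linear `ρ, γ, L` over `ℂ[x_σ]`,
`ρᵀ adj(1 − L) γ = det [[0, −ρᵀ], [γ, 1 − L]]`, an affine matrix on `Unit ⊕ Fin w ≃ Fin (w + 1)`.
[folklore] -/
theorem hasDetRepr_adjugate_contraction {σ : Type*} {w : ℕ}
    (ρ γ : Fin w → MvPolynomial σ ℂ) (L : Matrix (Fin w) (Fin w) (MvPolynomial σ ℂ))
    (hρ : ∀ i, (ρ i).IsHomogeneous 1) (hγ : ∀ i, (γ i).IsHomogeneous 1)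
    (hL : ∀ i j, (L i j).IsHomogeneous 1) :
    HasDetRepr (ρ ⬝ᵥ ((1 - L).adjugate *ᵥ γ)) (w + 1) := by
  classical
  have hDdet : (1 - L).det ≠ 0 := det_one_sub_ne_zero hL
  set B : Matrix (Unit ⊕ Fin w) (Unit ⊕ Fin w) (MvPolynomial σ ℂ) :=
    fromBlocks (of fun (_ _ : Unit) => 0) (replicateRow Unit (-ρ)) (replicateCol Unit γ) (1 - L)
    with hB
  have hBdet : B.det = ρ ⬝ᵥ ((1 - L).adjugate *ᵥ γ) := by
    rw [hB, VertexGauge.det_bordered 0 (-ρ) γ (1 - L) hDdet, zero_mul, zero_sub, neg_dotProduct,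
      neg_neg]
  have hBaff : ∀ i j, (B i j).totalDegree ≤ 1 := by
    rintro (i | i) (j | j)
    · simp [hB]
    · simp only [hB, fromBlocks_apply₁₂, replicateRow_apply, Pi.neg_apply, totalDegree_neg]
      exact (hρ j).totalDegree_le
    · simp only [hB, fromBlocks_apply₂₁, replicateCol_apply]
      exact (hγ i).totalDegree_le
    · simp only [hB, fromBlocks_apply₂₂]
      rw [Matrix.sub_apply, Matrix.one_apply]
      refine (totalDegree_sub _ _).trans (max_le ?_ (hL i j).totalDegree_le)
      split_ifs
      · rw [totalDegree_one]; exact Nat.zero_le _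
      · rw [totalDegree_zero]; exact Nat.zero_le _
  have hcard : Fintype.card (Unit ⊕ Fin w) = w + 1 := by
    rw [Fintype.card_sum, Fintype.card_unit, Fintype.card_fin, add_comm]
  set e : Unit ⊕ Fin w ≃ Fin (w + 1) := Fintype.equivFinOfCardEq hcard with he
  refine ⟨reindex e e B, fun i j => hBaff _ _, ?_⟩
  rw [det_reindex_self, hBdet]

/-- **(ii)+(iii) Low homogeneous components of the bordered adjugate form.**  For homogeneous
linear `ρ, γ, L` over `K[x_σ]` with `ρᵀ L^k γ = f` (`f` a form of degree `k + 2`) and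
`ρᵀ Lʲ γ = 0` for `j < k`, the component of degree `d ≤ k + 2` of `ρᵀ adj(1 − L) γ` is `f` if
`d = k + 2` and `0` otherwise (`adj(1 − L) = det(1 − L) Σ_{i ≤ k} Lⁱ + L^(k+1) adj(1 − L)`,
`det(1 − L) ≡ 1` modulo terms of positive degree). [folklore] -/
theorem homogeneousComponent_adjugate_contraction {σ : Type*} {K : Type*} [CommRing K]
    {k w : ℕ} {f : MvPolynomial σ K}
    (ρ γ : Fin w → MvPolynomial σ K) (L : Matrix (Fin w) (Fin w) (MvPolynomial σ K))
    (hf : f.IsHomogeneous (k + 2)) (hρ : ∀ i, (ρ i).IsHomogeneous 1)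
    (hγ : ∀ i, (γ i).IsHomogeneous 1) (hL : ∀ i j, (L i j).IsHomogeneous 1)
    (hA3 : ρ ⬝ᵥ (L ^ k *ᵥ γ) = f) (hA2 : ∀ j : ℕ, j < k → ρ ⬝ᵥ (L ^ j *ᵥ γ) = 0)
    (d : ℕ) (hd : d ≤ k + 2) :
    homogeneousComponent d (ρ ⬝ᵥ ((1 - L).adjugate *ᵥ γ)) = if d = k + 2 then f else 0 := by
  classical
  -- the decomposition with `N = k + 1`: `F = det (1 - L) * f + E`
  set E := ρ ⬝ᵥ ((L ^ (k + 1) * (1 - L).adjugate) *ᵥ γ) with hE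
  have key : ρ ⬝ᵥ ((1 - L).adjugate *ᵥ γ) = (1 - L).det * f + E := by
    have h := Krylov.adjugate_contraction_eq ρ γ L (k + 1)
    rw [Krylov.dotProduct_geom_sum_mulVec,
      Finset.sum_eq_single_of_mem k (Finset.mem_range.2 (Nat.lt_succ_self k)), hA3] at h
    · exact h
    · intro i hi hik
      exact hA2 i (by have := Finset.mem_range.1 hi; omega)
  -- `E` has no component of degree `≤ k + 2`
  have cE : homogeneousComponent d E = 0 := by
    rw [hE]
    simp only [dotProduct, Matrix.mulVec, Matrix.mul_apply, Finset.sum_mul, Finset.mul_sum, map_sum]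
    refine Finset.sum_eq_zero fun a _ => Finset.sum_eq_zero fun b _ =>
      Finset.sum_eq_zero fun c _ => ?_
    have hre : ρ a * ((L ^ (k + 1)) a c * (1 - L).adjugate c b * γ b) =
        (ρ a * (L ^ (k + 1)) a c * γ b) * (1 - L).adjugate c b := by ring
    rw [hre]
    exact Krylov.homogeneousComponent_mul_left_of_lt
      (((hρ a).mul (Krylov.isHomogeneous_pow_apply L hL (k + 1) a c)).mul (hγ b)) (by omega)
  rw [key, map_add, cE, add_zero, Krylov.homogeneousComponent_mul_right _ hf]
  by_cases hdk : d = k + 2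
  · subst hdk
    rw [if_pos le_rfl, if_pos rfl, Nat.sub_self, homogeneousComponent_zero, ← constantCoeff_eq,
      constantCoeff_det_one_sub hL, C_1, one_mul]
  · rw [if_neg (by omega), if_neg hdk]

end KrylovAdjugateOrder

/-- Registered stub **B3** `stub_krylovAdjugateOrder` of line `linear-homogenisation-transfer`:
for Krylov data (A2), (A3) of width `w` for `per_n` (`n ≥ 2`; homogeneous linear `ρ, γ, L` over
`ℂ[x_ij]`), the polynomial `F = ρᵀ adj(1 − L) γ` (i) is the determinant of the affine bordered
matrix `[[0, −ρᵀ], [γ, 1 − L]]` of size `w + 1` (`HasDetRepr F (w + 1)`), (ii) has no homogeneous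
component of degree `< n`, and (iii) has degree-`n` component `per_n`
(`Krylov.adjugate_contraction_eq ρ γ L (n − 1)`: `F = det(1 − L) · per_n + ρᵀ L^(n−1) adj(1 − L) γ`,
`det(1 − L) = 1 + (order ≥ 1)`, the last term has order `≥ n + 1`). [folklore] -/
theorem stub_krylovAdjugateOrder :
    ∀ (n w : ℕ) (ρ γ : Fin w → MvPolynomial (Fin n × Fin n) ℂ)
      (L : Matrix (Fin w) (Fin w) (MvPolynomial (Fin n × Fin n) ℂ)),
      2 ≤ n → (∀ i, (ρ i).IsHomogeneous 1) → (∀ i, (γ i).IsHomogeneous 1) →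
      (∀ i j, (L i j).IsHomogeneous 1) →
      ρ ⬝ᵥ ((L ^ (n - 2)) *ᵥ γ) = perPoly (Fin n) ℂ →
      (∀ j : ℕ, j < n - 2 → ρ ⬝ᵥ ((L ^ j) *ᵥ γ) = 0) →
      HasDetRepr (ρ ⬝ᵥ ((1 - L).adjugate *ᵥ γ)) (w + 1) ∧
      (∀ d : ℕ, d < n → homogeneousComponent d (ρ ⬝ᵥ ((1 - L).adjugate *ᵥ γ)) = 0) ∧
      homogeneousComponent n (ρ ⬝ᵥ ((1 - L).adjugate *ᵥ γ)) = perPoly (Fin n) ℂ := by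
  intro n w ρ γ L hn hρ hγ hL hA3 hA2
  obtain ⟨k, rfl⟩ : ∃ k, n = k + 2 := ⟨n - 2, by omega⟩
  have hper : (perPoly (Fin (k + 2)) ℂ).IsHomogeneous (k + 2) := by
    simpa using (perPoly_isHomogeneous (n := Fin (k + 2)) (k := ℂ))
  simp only [Nat.add_sub_cancel] at hA3 hA2
  have comp := KrylovAdjugateOrder.homogeneousComponent_adjugate_contraction ρ γ L hper hρ hγ hL
    hA3 hA2
  refine ⟨KrylovAdjugateOrder.hasDetRepr_adjugate_contraction ρ γ L hρ hγ hL, fun d hd => ?_, ?_⟩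
  · rw [comp d hd.le, if_neg (by omega)]
  · rw [comp (k + 2) le_rfl, if_pos rfl]

end Summit.ValiantsHypothesis.ValiantsHypothesis.Theorems.DetQPDetqpSuperquadratic
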